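import Literature.NumberTheory.Sieve.HeathBrownCubicETermRearrangement
import HarnessLib

/-!
# Heath-Brown 2001, Lemma 1: ideals `I` of `ℤ[∛2]` with `ρ(I) = 1`

Sixth proved layer of this seat under the named fact `HeathBrown2001_largestPrimeFactor_cubic`
(`LargestPrimeFactorCubic.lean`; D. R. Heath-Brown, *The largest prime factor of `X³ + 2`*, Proc.
London Math. Soc. (3) 82 (2001) 554–596), opening the sieve-theoretic half of the proof
(§§2–8), which works "with the set `𝒜 = {n + ∛2 : X < n ≤ 2X}` regarded as algebraic integers in
`ℚ(∛2)`" and the ideals `𝒜_I = {α ∈ 𝒜 : I ∣ α}` (p. 557).  The basic tool is **Lemma 1** (p. 557,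
"the verification of this is left to the reader"), about `ρ(I) = #{n (mod N(I)) : n ≡ ∛2 (mod I)}`:

> "If `n ≡ ∛2 (mod I)` is solvable with a rational integer `n`, then `I` is composed of first degree
> prime ideals only. Moreover `I` cannot be divisible by two distinct prime ideals of the same norm
> … In all other cases the congruence is solvable, and we have `ρ(I) = 1`. Moreover, if `I` is an
> ideal for which `ρ(I) = 1`, then for any `m ∈ ℤ`, we have `I ∣ m` if and only if `N(I) ∣ m`."

We PROVE, for the tree's model `K = ℚ(θ)`, `θ = ∛2`, `𝓞_K = ℤ[θ]`
(`Literature.NumberTheory.LFunctions.CubeRootTwoField`), and an ideal `I ∋ θ − m` (`m ∈ ℤ`, i.e.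
`ρ(I) = 1` with the root `m`):

* `ker_intCast_quotient_eq` — `ℤ → 𝓞_K/I` is onto (tree: `quotient_mk_comp_surjective`) with
  kernel `N(I)ℤ`; hence `intCast_mem_iff_absNorm_dvd` ("`I ∣ m` iff `N(I) ∣ m`") and
  `intCast_add_θint_mem_iff` (`n + θ ∈ I ↔ N(I) ∣ n + m`: the `n` with `I ∣ n + ∛2` form ONE residue
  class modulo `N(I)`, i.e. `ρ(I) = 1`, and `#𝒜_I = #{X < n ≤ 2X : n ≡ −m (mod N(I))}`);
* `eq_of_θint_sub_mem_of_absNorm_eq` — two ideals containing the same `θ − m` and of the same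
  norm coincide (both equal `(N, θ − m)`); in particular the ideal divisors of `(n + θ)` are
  determined by their norms ("cannot be divisible by two distinct prime ideals of the same norm"),
  which is how the multiplicities `#{L}` ≤ `2^{Ω}` and `#{K}` of §2 (p. 561) will be counted;
* `prime_absNorm_of_θint_sub_mem` — a prime ideal containing `θ − m` has prime norm ("composed of
  first degree prime ideals only"), and `le_of_prime_dvd_absNorm` — if every prime ideal factor of
  such an `I` has norm `≥ z` then every prime factor of `N(I)` is `≥ z`;
* `absNorm_span_natCast_add_θint` — `N((n + θ)) = n³ + 2`, and `absNorm_dvd_of_mem` —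
  `n + θ ∈ J ⇒ N(J) ∣ n³ + 2`.

Everything is elementary commutative algebra over Mathlib's `Ideal.absNorm`; no analytic input.

## References

* D. R. Heath-Brown, *The largest prime factor of `X³ + 2`*, Proc. London Math. Soc. (3) 82 (2001)
  554–596, §2, Lemma 1 (p. 557) and p. 561. [`HeathBrown2001LargestPrimeFactorCubic`]
* A. J. Irving, *The largest prime factor of `X³ + 2`*, Acta Arith. 171 (2015), Lemma 2.1 (the
  same lemma, restated). [`Irving2014LargestPrimeFactorCubic`]

## Mathlib / tree search

Mathlib: `Ideal.absNorm_mem`, `Ideal.absNorm_dvd_absNorm_of_le`, `Ideal.absNorm_eq_zero_iff`,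
`Ideal.absNorm_eq_one_iff`, `Ideal.dvd_iff_le`, `RingHom.quotientKerEquivOfSurjective`,
`Int.quotientSpanEquivZMod`, `Nat.card_zmod`, `Ideal.span_singleton_generator`, `Int.span_natAbs`,
`Ideal.prod_normalizedFactors_eq_self`, `Prime.exists_mem_multiset_dvd`.  Tree:
`CubeRootTwoField.quotient_mk_comp_surjective`, `.absNorm_eq_and_isMaximal`,
`.exists_prime_natCast_mem` (Heath-Brown's Lemma 3.1 of the Acta paper, prime norms only),
`CubicSieve.absNorm_span_add_mul_θint` (`N(x + yθ) = x³ + 2y³`).  No general `ρ(I) = 1` lemma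
existed (`lean search 'θint - .* ∈|absNorm_dvd.*θ'`).
-/

noncomputable section

open NumberField Finset

namespace Literature.NumberTheory.Sieve.LargestPrimeFactorCubic

open LFunctions.CubeRootTwoField CubicSieve

/-! ### The kernel of `ℤ → 𝓞_K/I` for `I ∋ θ − m` -/

/-- For an ideal `I ∋ θ − m` (`m ∈ ℤ`) the map `ℤ → 𝓞_K/I` (onto, `quotient_mk_comp_surjective`)
has kernel `N(I)ℤ`: indeed `ℤ/ker ≅ 𝓞_K/I` has `N(I)` elements.
[cite: HeathBrown2001LargestPrimeFactorCubic, Lemma 1] -/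
theorem ker_intCast_quotient_eq {I : Ideal (𝓞 K)} {m : ℤ} (hm : θint - m ∈ I) :
    RingHom.ker ((Ideal.Quotient.mk I).comp (algebraMap ℤ (𝓞 K))) =
      Ideal.span {((Ideal.absNorm I : ℕ) : ℤ)} := by
  set φ := (Ideal.Quotient.mk I).comp (algebraMap ℤ (𝓞 K)) with hφ
  have hsurj : Function.Surjective φ := quotient_mk_comp_surjective hm
  set d : ℤ := Submodule.IsPrincipal.generator (RingHom.ker φ) with hd
  have hker : RingHom.ker φ = Ideal.span {d} := (Ideal.span_singleton_generator _).symm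
  -- `ℤ/(d) ≃ 𝓞_K/I`, so `|d| = N(I)`
  have e : (ℤ ⧸ Ideal.span ({d} : Set ℤ)) ≃+* (𝓞 K ⧸ I) :=
    (Ideal.quotEquivOfEq hker.symm).trans (RingHom.quotientKerEquivOfSurjective hsurj)
  have hcard : d.natAbs = Ideal.absNorm I := by
    rw [Ideal.absNorm_apply, Submodule.cardQuot_apply, ← Nat.card_congr e.toEquiv,
      Nat.card_congr (Int.quotientSpanEquivZMod d).toEquiv, Nat.card_zmod]
  rw [hker, ← hcard, Int.span_natAbs]

/-- **Lemma 1, last clause**: for `I ∋ θ − m` and a rational integer `x`, "`I ∣ x` if and only if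
`N(I) ∣ x`". [cite: HeathBrown2001LargestPrimeFactorCubic, Lemma 1] -/
theorem intCast_mem_iff_absNorm_dvd {I : Ideal (𝓞 K)} {m : ℤ} (hm : θint - m ∈ I) (x : ℤ) :
    (x : 𝓞 K) ∈ I ↔ ((Ideal.absNorm I : ℕ) : ℤ) ∣ x := by
  have h := ker_intCast_quotient_eq hm
  have hx : (x : 𝓞 K) ∈ I ↔ x ∈ RingHom.ker ((Ideal.Quotient.mk I).comp (algebraMap ℤ (𝓞 K))) := by
    rw [RingHom.mem_ker, RingHom.comp_apply, Ideal.Quotient.eq_zero_iff_mem, algebraMap_int_eq,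
      eq_intCast]
  rw [hx, h, Ideal.mem_span_singleton]

/-- **`ρ(I) = 1`**: for `I ∋ θ − m`, `n + θ ∈ I ↔ N(I) ∣ n + m` — the `n ∈ ℤ` with `I ∣ n + ∛2`
form the single residue class `−m (mod N(I))` (Heath-Brown: "`ρ(I) = 1`"; `#𝒜_I` is then the
number of `n ∈ (X, 2X]` in that class). [cite: HeathBrown2001LargestPrimeFactorCubic, Lemma 1] -/
theorem intCast_add_θint_mem_iff {I : Ideal (𝓞 K)} {m : ℤ} (hm : θint - m ∈ I) (n : ℤ) :
    (n : 𝓞 K) + θint ∈ I ↔ ((Ideal.absNorm I : ℕ) : ℤ) ∣ n + m := by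
  rw [← intCast_mem_iff_absNorm_dvd hm]
  have e : (n : 𝓞 K) + θint = ((n + m : ℤ) : 𝓞 K) + (θint - m) := by push_cast; ring
  rw [e]
  refine ⟨fun h => ?_, fun h => I.add_mem h hm⟩
  have h' := I.sub_mem h hm
  rwa [add_sub_cancel_right] at h'

/-- The same for natural `n`: `n + θ ∈ I ↔ N(I) ∣ n + m` in `ℤ`.
[cite: HeathBrown2001LargestPrimeFactorCubic, Lemma 1] -/
theorem natCast_add_θint_mem_iff {I : Ideal (𝓞 K)} {m : ℤ} (hm : θint - m ∈ I) (n : ℕ) :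
    (n : 𝓞 K) + θint ∈ I ↔ ((Ideal.absNorm I : ℕ) : ℤ) ∣ (n : ℤ) + m := by
  rw [← intCast_add_θint_mem_iff hm]
  push_cast
  exact Iff.rfl

/-- If `n + θ ∈ I` then `θ − (−n) ∈ I`: the ideal divisors of `(n + θ)` have `ρ = 1` with the root
`m = −n`. [cite: HeathBrown2001LargestPrimeFactorCubic, Lemma 1] -/
theorem θint_sub_neg_mem_of_add_θint_mem {I : Ideal (𝓞 K)} {n : ℤ} (h : (n : 𝓞 K) + θint ∈ I) :
    θint - ((-n : ℤ) : 𝓞 K) ∈ I := by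
  have e : θint - ((-n : ℤ) : 𝓞 K) = (n : 𝓞 K) + θint := by push_cast; ring
  rwa [e]

/-! ### Ideals with `ρ = 1` are determined by their norms -/

/-- The ideal `(N, θ − m)` inside any `I ∋ θ − m` of norm `N ≠ 0` IS `I`: it is contained in `I`,
and its norm divides `N` (it contains `N`, and has `ρ = 1`) and is a multiple of `N(I) = N`; an
ideal inside another of the same nonzero norm equals it (`I' = I · L` with `N(L) = 1`).
[cite: HeathBrown2001LargestPrimeFactorCubic, Lemma 1] -/
theorem span_absNorm_θint_sub_eq {I : Ideal (𝓞 K)} (hI : I ≠ ⊥) {m : ℤ} (hm : θint - m ∈ I) :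
    Ideal.span {((Ideal.absNorm I : ℕ) : 𝓞 K), θint - m} = I := by
  set N := Ideal.absNorm I with hNdef
  set I' : Ideal (𝓞 K) := Ideal.span {((N : ℕ) : 𝓞 K), θint - m} with hI'
  have hN0 : N ≠ 0 := by rwa [hNdef, Ne, Ideal.absNorm_eq_zero_iff]
  have hNI' : ((N : ℕ) : 𝓞 K) ∈ I' := Ideal.subset_span (Set.mem_insert _ _)
  have hmI' : θint - m ∈ I' := Ideal.subset_span (Set.mem_insert_of_mem _ rfl)
  have hle : I' ≤ I := by
    rw [hI', Ideal.span_le]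
    rintro z (rfl | hz)
    · exact Ideal.absNorm_mem I
    · rw [Set.mem_singleton_iff] at hz; rw [hz]; exact hm
  -- `N(I') ∣ N` and `N ∣ N(I')`, so `N(I') = N`
  have h1 : Ideal.absNorm I' ∣ N := by
    have := (intCast_mem_iff_absNorm_dvd hmI' (N : ℤ)).1 (by exact_mod_cast hNI')
    exact_mod_cast this
  have h2 : N ∣ Ideal.absNorm I' := Ideal.absNorm_dvd_absNorm_of_le hle
  have heq : Ideal.absNorm I' = N := Nat.dvd_antisymm h1 h2
  -- `I' = I · L` with `N(L) = 1`, i.e. `L = ⊤`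
  obtain ⟨L, hL⟩ := Ideal.dvd_iff_le.2 hle
  have h3 : N * Ideal.absNorm L = N * 1 := by
    rw [hNdef, ← map_mul, ← hL, heq, mul_one]
  have hL1 : Ideal.absNorm L = 1 := mul_left_cancel₀ hN0 h3
  rw [Ideal.absNorm_eq_one_iff] at hL1
  rw [hL, hL1, Ideal.mul_top]

/-- **Lemma 1, uniqueness**: two ideals containing the same `θ − m` and having the same norm are
equal ("`I` cannot be divisible by two distinct prime ideals of the same norm"; more generally the
ideal divisors of `(n + ∛2)` are determined by their norms).
[cite: HeathBrown2001LargestPrimeFactorCubic, Lemma 1] -/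
theorem eq_of_θint_sub_mem_of_absNorm_eq {I J : Ideal (𝓞 K)} (hI : I ≠ ⊥) {m : ℤ}
    (hmI : θint - m ∈ I) (hmJ : θint - m ∈ J) (h : Ideal.absNorm I = Ideal.absNorm J) : I = J := by
  have hJ : J ≠ ⊥ := by
    intro h0
    rw [h0, Ideal.absNorm_bot, Ideal.absNorm_eq_zero_iff] at h
    exact hI h
  rw [← span_absNorm_θint_sub_eq hI hmI, ← span_absNorm_θint_sub_eq hJ hmJ, h]

/-! ### Prime ideal factors have prime norms -/

/-- **Lemma 1, first clause**: a nonzero prime ideal containing `θ − m` is of the first degree —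
its norm is a rational prime. [cite: HeathBrown2001LargestPrimeFactorCubic, Lemma 1] -/
theorem prime_absNorm_of_θint_sub_mem {P : Ideal (𝓞 K)} (hP : P.IsPrime) (hP0 : P ≠ ⊥) {m : ℤ}
    (hm : θint - m ∈ P) : (Ideal.absNorm P).Prime := by
  obtain ⟨q, hq, hqP⟩ := exists_prime_natCast_mem hP hP0
  rw [(absNorm_eq_and_isMaximal hq hqP hm hP.ne_top).1]
  exact hq

/-- If `I ∋ θ − m` is nonzero and every prime ideal factor `P` of `I` has `N(P) ≥ z`, then every
prime factor of `N(I)` is `≥ z` (`N(I) = ∏ N(P)^{e_P}` with the `N(P)` prime).  This turns the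
sieve condition "`L` is composed only of prime ideals `P` with `N(P) ≥ X^δ`" (p. 560) into
"`N(L)` has no prime factor `< X^δ`", and conversely bounds the number of such `L ∣ (n + ∛2)`
by the number of `X^δ`-rough divisors of `n³ + 2`.
[cite: HeathBrown2001LargestPrimeFactorCubic, §2 pp. 560–561] -/
theorem le_of_prime_dvd_absNorm {I : Ideal (𝓞 K)} (hI : I ≠ ⊥) {m : ℤ} (hm : θint - m ∈ I)
    {z : ℕ} (hrough : ∀ P : Ideal (𝓞 K), P.IsPrime → P ≠ ⊥ → I ≤ P → z ≤ Ideal.absNorm P)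
    {p : ℕ} (hp : p.Prime) (hpd : p ∣ Ideal.absNorm I) : z ≤ p := by
  classical
  set F := UniqueFactorizationMonoid.normalizedFactors I with hF
  have hprod : Ideal.absNorm I = (F.map Ideal.absNorm).prod := by
    conv_lhs => rw [← Ideal.prod_normalizedFactors_eq_self hI]
    rw [← hF, map_multiset_prod]
  rw [hprod] at hpd
  obtain ⟨a, ha, hpa⟩ := (Nat.prime_iff.1 hp).exists_mem_multiset_dvd hpd
  obtain ⟨P, hPF, rfl⟩ := Multiset.mem_map.1 ha
  have hPmem := (Ideal.mem_normalizedFactors_iff hI).1 hPF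
  have hP0 : P ≠ ⊥ := by
    rintro rfl
    exact UniqueFactorizationMonoid.zero_notMem_normalizedFactors I (by rwa [Ideal.zero_eq_bot])
  have hle : I ≤ P := hPmem.2
  have hNP : (Ideal.absNorm P).Prime := prime_absNorm_of_θint_sub_mem hPmem.1 hP0 (hle hm)
  rw [(Nat.prime_dvd_prime_iff_eq hp hNP).1 hpa]
  exact hrough P hPmem.1 hP0 hle

/-- Conversely (trivially): if every prime factor of `N(I)` is `≥ z` then every prime ideal factor
`P` of `I ∋ θ − m` has `N(P) ≥ z` (`N(P)` is a prime dividing `N(I)`).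
[cite: HeathBrown2001LargestPrimeFactorCubic, §2 p. 560] -/
theorem le_absNorm_of_prime_le {I : Ideal (𝓞 K)} {m : ℤ} (hm : θint - m ∈ I) {z : ℕ}
    (hrough : ∀ p : ℕ, p.Prime → p ∣ Ideal.absNorm I → z ≤ p)
    {P : Ideal (𝓞 K)} (hP : P.IsPrime) (hP0 : P ≠ ⊥) (hle : I ≤ P) : z ≤ Ideal.absNorm P :=
  hrough _ (prime_absNorm_of_θint_sub_mem hP hP0 (hle hm)) (Ideal.absNorm_dvd_absNorm_of_le hle)

/-! ### The elements `n + θ` of `𝒜` -/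

/-- `N((n + θ)) = |n³ + 2|` for `n ∈ ℤ` (the norm form `x³ + 2y³` at `y = 1`).
[cite: HeathBrown2001LargestPrimeFactorCubic, §2 p. 557] -/
theorem absNorm_span_intCast_add_θint (n : ℤ) :
    Ideal.absNorm (Ideal.span {((n : 𝓞 K) + θint : 𝓞 K)}) = (n ^ 3 + 2).natAbs := by
  have h := absNorm_span_add_mul_θint n 1
  simp only [Int.cast_one, one_mul, one_pow, mul_one] at h
  exact h

/-- `N((n + θ)) = n³ + 2` for `n ∈ ℕ` ("`log(n³ + 2) = log N(n + ∛2)`", p. 557).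
[cite: HeathBrown2001LargestPrimeFactorCubic, §2 p. 557] -/
theorem absNorm_span_natCast_add_θint (n : ℕ) :
    Ideal.absNorm (Ideal.span {((n : 𝓞 K) + θint : 𝓞 K)}) = n ^ 3 + 2 := by
  have h := absNorm_span_intCast_add_θint (n : ℤ)
  rw [show ((n : ℤ) : 𝓞 K) = (n : 𝓞 K) by push_cast; rfl] at h
  rw [h, show (n : ℤ) ^ 3 + 2 = ((n ^ 3 + 2 : ℕ) : ℤ) by push_cast; ring, Int.natAbs_natCast]

/-- `(n + θ) ≠ 0`. [folklore] -/
theorem span_natCast_add_θint_ne_bot (n : ℕ) :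
    Ideal.span {((n : 𝓞 K) + θint : 𝓞 K)} ≠ ⊥ := by
  intro h
  have := absNorm_span_natCast_add_θint n
  rw [h, Ideal.absNorm_bot] at this
  omega

/-- An ideal `J ∋ n + θ` (i.e. `J ∣ (n + ∛2)`) has `N(J) ∣ n³ + 2` — the rational shadow of the
ideal divisors `KL ∣ n + ∛2` of §2 (p. 560: "`log^{(1)}(n³+2) ≥ ∑_{I ∣ J} Λ(I) = log N(J)`").
[cite: HeathBrown2001LargestPrimeFactorCubic, §2 p. 560] -/
theorem absNorm_dvd_of_natCast_add_θint_mem {J : Ideal (𝓞 K)} {n : ℕ}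
    (h : (n : 𝓞 K) + θint ∈ J) : Ideal.absNorm J ∣ n ^ 3 + 2 := by
  rw [← absNorm_span_natCast_add_θint n]
  exact Ideal.absNorm_dvd_absNorm_of_le ((Ideal.span_singleton_le_iff_mem _).2 h)

/-- An ideal `J ∋ n + θ` is nonzero. [folklore] -/
theorem ne_bot_of_natCast_add_θint_mem {J : Ideal (𝓞 K)} {n : ℕ} (h : (n : 𝓞 K) + θint ∈ J) :
    J ≠ ⊥ := by
  intro hJ
  have hle : Ideal.span {((n : 𝓞 K) + θint : 𝓞 K)} ≤ J := (Ideal.span_singleton_le_iff_mem _).2 h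
  rw [hJ, le_bot_iff] at hle
  exact span_natCast_add_θint_ne_bot n hle

/-- For `J ∋ n + θ` (`n ∈ ℕ`): `n' + θ ∈ J ↔ N(J) ∣ n' − n` — `𝒜_J` is the trace on `(X, 2X]` of the
residue class `n (mod N(J))`. [cite: HeathBrown2001LargestPrimeFactorCubic, Lemma 1] -/
theorem natCast_add_θint_mem_iff_of_mem {J : Ideal (𝓞 K)} {n : ℕ} (h : (n : 𝓞 K) + θint ∈ J)
    (n' : ℕ) : (n' : 𝓞 K) + θint ∈ J ↔ ((Ideal.absNorm J : ℕ) : ℤ) ∣ (n' : ℤ) - n := by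
  have hm : θint - ((-(n : ℤ) : ℤ) : 𝓞 K) ∈ J :=
    θint_sub_neg_mem_of_add_θint_mem (by exact_mod_cast h)
  rw [natCast_add_θint_mem_iff hm n', sub_eq_add_neg]

/-- Two ideals containing the same `n + θ` and of the same norm are equal (the map `J ↦ N(J)`
is injective on the ideal divisors of `(n + ∛2)`). [cite: HeathBrown2001LargestPrimeFactorCubic, Lemma 1] -/
theorem eq_of_natCast_add_θint_mem_of_absNorm_eq {I J : Ideal (𝓞 K)} {n : ℕ}
    (hI : (n : 𝓞 K) + θint ∈ I) (hJ : (n : 𝓞 K) + θint ∈ J)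
    (h : Ideal.absNorm I = Ideal.absNorm J) : I = J :=
  eq_of_θint_sub_mem_of_absNorm_eq (ne_bot_of_natCast_add_θint_mem hI)
    (θint_sub_neg_mem_of_add_θint_mem (n := n) (by exact_mod_cast hI))
    (θint_sub_neg_mem_of_add_θint_mem (n := n) (by exact_mod_cast hJ)) h

/-- A nonzero prime ideal containing `n + θ` has prime norm dividing `n³ + 2`.
[cite: HeathBrown2001LargestPrimeFactorCubic, Lemma 1] -/
theorem prime_absNorm_of_natCast_add_θint_mem {P : Ideal (𝓞 K)} (hP : P.IsPrime) {n : ℕ}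
    (h : (n : 𝓞 K) + θint ∈ P) : (Ideal.absNorm P).Prime ∧ Ideal.absNorm P ∣ n ^ 3 + 2 :=
  ⟨prime_absNorm_of_θint_sub_mem hP (ne_bot_of_natCast_add_θint_mem h)
    (θint_sub_neg_mem_of_add_θint_mem (n := n) (by exact_mod_cast h)),
    absNorm_dvd_of_natCast_add_θint_mem h⟩

/-- If every prime ideal factor of `J ∋ n + θ` has norm `≥ z`, then every prime factor of `N(J)`
is `≥ z`. [cite: HeathBrown2001LargestPrimeFactorCubic, §2 p. 561] -/
theorem le_of_prime_dvd_absNorm_of_natCast_add_θint_mem {J : Ideal (𝓞 K)} {n : ℕ}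
    (h : (n : 𝓞 K) + θint ∈ J) {z : ℕ}
    (hrough : ∀ P : Ideal (𝓞 K), P.IsPrime → P ≠ ⊥ → J ≤ P → z ≤ Ideal.absNorm P)
    {p : ℕ} (hp : p.Prime) (hpd : p ∣ Ideal.absNorm J) : z ≤ p :=
  le_of_prime_dvd_absNorm (ne_bot_of_natCast_add_θint_mem h)
    (θint_sub_neg_mem_of_add_θint_mem (n := n) (by exact_mod_cast h)) hrough hp hpd

end Literature.NumberTheory.Sieve.LargestPrimeFactorCubic
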